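/-
Copyright (c) 2026. All rights reserved.
Released under Apache 2.0 license as described in the file LICENSE.
Origin: expansion seat `planner-pub-hodgecm-qw8-0` (unit pub-hodgecm-qw8), handover v2 2026-08-18T03:13:07Z (`HOME/pub-hodgecm-qw8/Qw8CorCM.lean`, md5 80f36efb);
landed by the gen-5 packager as `HodgeCM/Assembly/CorCMQw8.lean` (`import Qw8FaceBridge` → `import HodgeCM.StubTree.Qw8FaceBridge`; trailing `#print axioms` moved to the audit lists; body otherwise verbatim).
-/
import Summits.HodgeConjecture.HodgeCM.Assembly.CorCM
import Summits.HodgeConjecture.HodgeCM.StubTree.Qw8FaceBridge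

/-!
# COR-CM with the finer [QW8] inputs

The headline `HodgeCM.Assembly.COR_CM` takes the monolithic `U.Qw8Sufficiency`.  With the v1 split
(`HodgeCM/StubTree/Qw8.lean`) and the v2 discharge of the ā-bridge from the model axioms
(`qw8Sufficiency_of_modelAxioms`), the same conclusion follows from the THREE remaining [QW8] Thm 2.5
steps as named hypotheses: (ii) `Qw8ExtProd`, (iii)+(v) `Qw8DualPushPull`, (iv) `Qw8Milne` (= Milne 1999,
the print input).  One line; recorded so that the closure audit displays the finer open inputs.
(WIP import name `Qw8FaceBridge` = the v2 file `pub-hodgecm-qw8/Qw8FaceBridge.lean`; the packager renames.)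
-/

noncomputable section

namespace HodgeCM

namespace Assembly

/-- **COR-CM from the three remaining [QW8] Thm 2.5 steps** (exterior products, duality / push–pull,
Milne 1999) in place of the monolithic `Qw8Sufficiency`; the conjugation step (i) and the §3 ā-bridge are
theorems of the model (`HodgeCM.Universe.qw8Conj_holds`, `HodgeCM.Universe.qw8FaceBridge_holds`). -/
theorem COR_CM_of_qw8Steps (U : Universe) (M : U.ModelAxioms) (hR : U.RealisationExistsFace)
    (hP : U.PohlmannSpan) (hE : U.Qw8ExtProd) (hD : U.Qw8DualPushPull) (hMi : U.Qw8Milne) : U.HC_CM :=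
  COR_CM U M hR hP (U.qw8Sufficiency_of_modelAxioms M hE hD hMi)

end Assembly

end HodgeCM

end
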